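import Literature.MathematicalPhysics.QuantumFieldTheory.ConstructiveQFTWave0OddRPProofs
import Literature.MathematicalPhysics.QuantumFieldTheory.ConstructiveQFTWave0SiteRPProofs
import Literature.MathematicalPhysics.QuantumFieldTheory.LatticeGaugeProofs
import HarnessLib

/-!
# Odd-torus reflection positivity in site-reflection coordinates `t ↦ −t`

`ConstructiveQFTWave0OddRPProofs` proves Osterwalder–Seiler reflection positivity of the Wilson
measure on the ODD torus `(ℤ/Lℤ)^d`, `L = 2S+1`, in the coordinates in which the reflection is
`θ t = 1 − t` (`GaugeConfig.timeReflect`): the crossing temporal links are `0 → 1`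
(`WilsonOddRP.lowerEdges`), the positive block is `1 ≤ t ≤ S` and the shared spatial links sit in the
slice `t = S + 1` (`wilsonExpectation_nonneg_of_oddCovariant`).  The lattice-QCD objects of
`QCDTimeReflection` (the OS adjoint `osAdjoint`, the antiperiodic layer `apLinkSign`, the torus
functional `qcdTorusExpectAP`) use the SITE reflection `t ↦ −t` (`GaugeConfig.negReflect`), whose
fixed hyperplanes on the odd torus are the slice `t = 0` (shared spatial links) and the temporal link
layer `S → S+1`.  The two pictures differ by the time translation `t ↦ t − S`; this file transports the
covariant positivity theorem along that translation (`wilsonMeasure` is translation invariant,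
`wilsonExpectation_comp_torusConfigShift`):

* `layerEdges S`, `negSideEdges S`, `sliceZeroEdges` — the temporal links `S → S+1`, the links based
  at times `S+1 ≤ t ≤ L−1`, the spatial links of the slice `t = 0`;
* `translateLayer S Y U` — the Osterwalder–Seiler split `U_e ↦ U_e Y_e` of the layer links;
* `wilsonExpectation_nonneg_of_negCovariant` — if a measurable `Φ` satisfies
  `Φ (translateLayer S Y U) = Σₖ gₖ(splice_{layer}(U, Y)) · conj gₖ(negReflect U)` for finitely many
  bounded measurable `gₖ` depending only on `negSideEdges ∪ layerEdges ∪ sliceZeroEdges`, then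
  `⟨Φ⟩_{Λ,β} ≥ 0` (`β ≥ 0`, continuous `ρ`, `1 ≤ S`).

Everything is proved; no named fact.

## Sources

K. Osterwalder, E. Seiler, Ann. Phys. 110 (1978) 440, §2; E. Seiler, LNP 159 (1982), Ch. 2;
J. Fröhlich, R. Israel, E. H. Lieb, B. Simon, Commun. Math. Phys. 62 (1978) 1, Thm. 2.1.
-/

open MeasureTheory Finset Complex
open scoped ComplexOrder ComplexConjugate

namespace Literature.MathematicalPhysics.QuantumFieldTheory

noncomputable section

namespace WilsonNegRP

open WilsonRP WilsonOddRP

variable {d L : ℕ} [NeZero d] [NeZero L]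

/-- The antiperiodic / crossing layer of temporal links `S → S+1`. [folklore] -/
def layerEdges (S : ℕ) : Finset (Edge d L) := univ.filter fun e => e.2 = 0 ∧ (e.1 0).val = S

/-- The links of the negative half: base point at times `S + 1 ≤ t ≤ L − 1`. [folklore] -/
def negSideEdges (S : ℕ) : Finset (Edge d L) := univ.filter fun e => S + 1 ≤ (e.1 0).val

/-- The shared spatial links of the reflection slice `t = 0`. [folklore] -/
def sliceZeroEdges : Finset (Edge d L) := univ.filter fun e => e.2 ≠ 0 ∧ (e.1 0).val = 0

/-- The Osterwalder–Seiler split of the layer links: `U_e ↦ U_e Y_e` on `layerEdges S` only. [cite: OsterwalderSeiler1978, §2] -/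
def translateLayer {G : Type*} [Group G] (S : ℕ) (Y U : GaugeConfig d L G) : GaugeConfig d L G :=
  fun e => U e * (if e.2 = 0 ∧ (e.1 0).val = S then Y e else 1)

/-- The translation vector `S e₀`. [folklore] -/
def shiftVec (S : ℕ) : Site d L := Pi.single 0 (S : ZMod L)

omit [NeZero L] in
/-- Time coordinate of a translated site. [folklore] -/
theorem sub_shiftVec_apply_zero (S : ℕ) (x : Site d L) :
    (x - shiftVec (d := d) (L := L) S) 0 = x 0 - (S : ZMod L) := by
  simp [shiftVec]

omit [NeZero L] in
/-- Spatial coordinates are not translated. [folklore] -/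
theorem sub_shiftVec_apply_of_ne (S : ℕ) (x : Site d L) {k : Fin d} (hk : k ≠ 0) :
    (x - shiftVec (d := d) (L := L) S) k = x k := by
  simp [shiftVec, hk]

section Arith

variable {S : ℕ} (hL : L = 2 * S + 1)
include hL

omit [NeZero L] in
/-- `(S : ZMod L).val = S`. [folklore] -/
theorem val_S : ((S : ℕ) : ZMod L).val = S := ZMod.val_cast_of_lt (by omega)

/-- The translated time of a link of the negative half lies in `[1, S]`. [folklore] -/
theorem val_sub_of_negSide {x : Site d L} (h : S + 1 ≤ (x 0).val) :
    1 ≤ (x 0 - (S : ZMod L)).val ∧ (x 0 - (S : ZMod L)).val ≤ L / 2 := by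
  have hlt := ZMod.val_lt (x 0)
  rw [ZMod.val_sub (by rw [val_S hL]; omega), val_S hL]
  omega

/-- The translated time of a layer link is `0`, and conversely. [folklore] -/
theorem val_sub_eq_zero_iff (x : Site d L) : (x 0 - (S : ZMod L)).val = 0 ↔ (x 0).val = S := by
  rw [ZMod.val_eq_zero, sub_eq_zero]
  constructor
  · intro h; rw [h, val_S hL]
  · intro h
    rw [← ZMod.natCast_zmod_val (x 0), h]

/-- The translated time of the slice `t = 0` is `L/2 + 1 = S + 1`. [folklore] -/
theorem val_sub_of_zero (hS : 1 ≤ S) {x : Site d L} (h : (x 0).val = 0) :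
    (x 0 - (S : ZMod L)).val = L / 2 + 1 := by
  have hx : x 0 = 0 := (ZMod.val_eq_zero _).1 h
  rw [hx, zero_sub, ZMod.neg_val, val_S hL, if_neg]
  · omega
  · intro h0
    have := congrArg ZMod.val h0
    rw [val_S hL, ZMod.val_zero] at this
    omega

omit [NeZero L] in
/-- `2S + 1 = 0` in `ZMod L`. [folklore] -/
theorem two_S_add_one_eq_zero : (2 * (S : ZMod L) + 1) = 0 := by
  have : ((2 * S + 1 : ℕ) : ZMod L) = 0 := by rw [← hL]; exact ZMod.natCast_self L
  push_cast at this
  exact this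

end Arith

variable {G : Type*}

omit [NeZero L] in
/-- **The translation conjugates the two reflections**: `negReflect (τU') = τ (timeReflect U')`,
`τ = torusConfigShift (S e₀)` (`−t − S = 1 − (t − S) − (2S+1)`). [folklore] -/
theorem negReflect_torusConfigShift [Group G] [MeasurableSpace G] {S : ℕ} (hL : L = 2 * S + 1) (U' : GaugeConfig d L G) :
    (torusConfigShift (shiftVec S) U').negReflect = torusConfigShift (shiftVec S) U'.timeReflect := by
  have h2 := two_S_add_one_eq_zero (L := L) hL
  funext ⟨x, i⟩
  by_cases hi : i = 0
  · subst hi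
    simp only [GaugeConfig.negReflect, ↓reduceIte, torusConfigShift_apply, GaugeConfig.timeReflect]
    congr 2
    refine Prod.ext ?_ rfl
    funext k
    dsimp only
    by_cases hk : k = 0
    · subst hk
      rw [sub_shiftVec_apply_zero, WilsonSiteRP.negReflect_apply_zero, shift_apply_self,
        timeReflect_apply_zero, shift_apply_self, sub_shiftVec_apply_zero]
      linear_combination -h2
    · rw [sub_shiftVec_apply_of_ne _ _ hk, WilsonSiteRP.negReflect_apply_of_ne _ hk, shift_apply_of_ne _ hk,
        timeReflect_apply_of_ne _ hk, shift_apply_of_ne _ hk, sub_shiftVec_apply_of_ne _ _ hk]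
  · simp only [GaugeConfig.negReflect, if_neg hi, torusConfigShift_apply, GaugeConfig.timeReflect]
    congr 1
    refine Prod.ext ?_ rfl
    funext k
    dsimp only
    by_cases hk : k = 0
    · subst hk
      rw [sub_shiftVec_apply_zero, WilsonSiteRP.negReflect_apply_zero, timeReflect_apply_zero,
        sub_shiftVec_apply_zero]
      linear_combination -h2
    · rw [sub_shiftVec_apply_of_ne _ _ hk, WilsonSiteRP.negReflect_apply_of_ne _ hk,
        timeReflect_apply_of_ne _ hk, sub_shiftVec_apply_of_ne _ _ hk]

/-- The translation conjugates the two link splittings: `τ (translateLow Y' U') = translateLayer S (τY') (τU')`. [folklore] -/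
theorem torusConfigShift_translateLow [Group G] [MeasurableSpace G] {S : ℕ} (hL : L = 2 * S + 1) (Y' U' : GaugeConfig d L G) :
    torusConfigShift (shiftVec S) (translateLow Y' U') =
      translateLayer S (torusConfigShift (shiftVec S) Y') (torusConfigShift (shiftVec S) U') := by
  funext ⟨x, i⟩
  simp only [torusConfigShift_apply, translateLow, translateLayer, IsLowerCross, sub_shiftVec_apply_zero,
    val_sub_eq_zero_iff hL]

/-- The translation conjugates the two splices: `splice_{layer} (τU', τY') = τ (splice_{lower} (U', Y'))`. [folklore] -/
theorem splice_layerEdges_torusConfigShift [MeasurableSpace G] {S : ℕ} (hL : L = 2 * S + 1)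
    (U' Y' : GaugeConfig d L G) :
    LatticeRP.splice (layerEdges S) (torusConfigShift (shiftVec S) U', torusConfigShift (shiftVec S) Y') =
      torusConfigShift (shiftVec S) (LatticeRP.splice lowerEdges (U', Y')) := by
  funext ⟨x, i⟩
  simp only [LatticeRP.splice_apply, torusConfigShift_apply, layerEdges, mem_filter, mem_univ, true_and,
    mem_lowerEdges, IsLowerCross, sub_shiftVec_apply_zero, val_sub_eq_zero_iff hL]

/-- The translation carries our blocks `negSide ∪ layer ∪ slice 0` into Wave 0's `P ∪ C ∪ M`. [folklore] -/
theorem mem_blocks_of_mem {S : ℕ} (hL : L = 2 * S + 1) (hS : 1 ≤ S) {e : Edge d L}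
    (he : e ∈ (negSideEdges S ∪ layerEdges S ∪ sliceZeroEdges : Finset (Edge d L))) :
    ((e.1 - shiftVec S, e.2) : Edge d L) ∈ (oPosEdges ∪ lowerEdges ∪ oSharedEdges : Finset (Edge d L)) := by
  simp only [mem_union, negSideEdges, layerEdges, sliceZeroEdges, mem_filter, mem_univ, true_and] at he
  simp only [mem_union, mem_oPosEdges, mem_lowerEdges, mem_oSharedEdges, IsOPosEdge, IsLowerCross,
    IsOSharedEdge]
  rw [sub_shiftVec_apply_zero]
  rcases he with (h | ⟨h2, hS'⟩) | ⟨h2, h0⟩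
  · exact Or.inl (Or.inl (val_sub_of_negSide hL h))
  · exact Or.inl (Or.inr ⟨h2, (val_sub_eq_zero_iff hL _).2 hS'⟩)
  · exact Or.inr ⟨h2, val_sub_of_zero hL hS h0⟩

/-- A function of our blocks, read through the translation, is a function of Wave 0's blocks. [folklore] -/
theorem dependsOn_comp_torusConfigShift [MeasurableSpace G] {S : ℕ} (hL : L = 2 * S + 1) (hS : 1 ≤ S)
    {g : GaugeConfig d L G → ℂ}
    (hg : DependsOn g (↑(negSideEdges S ∪ layerEdges S ∪ sliceZeroEdges : Finset (Edge d L)) : Set (Edge d L))) :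
    DependsOn (g ∘ torusConfigShift (shiftVec S))
      (↑(oPosEdges ∪ lowerEdges ∪ oSharedEdges : Finset (Edge d L)) : Set (Edge d L)) := by
  intro U' V' hUV
  simp only [Function.comp_apply]
  refine hg fun e he => ?_
  rw [torusConfigShift_apply, torusConfigShift_apply]
  exact hUV _ (mem_coe.2 (mem_blocks_of_mem hL hS (mem_coe.1 he)))

end WilsonNegRP

/-! ## The positivity theorem in site-reflection coordinates -/

section Main

open WilsonNegRP

variable {d L N : ℕ} {G : Type*} [Group G] [TopologicalSpace G] [IsTopologicalGroup G]
  [CompactSpace G] [MeasurableSpace G] [BorelSpace G] (ρ : G →* Matrix (Fin N) (Fin N) ℂ)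

/-- **Osterwalder–Seiler reflection positivity on the odd torus, covariant form, in the site-reflection
coordinates `t ↦ −t`** (torus `(ℤ/Lℤ)^d`, `L = 2S+1`, `S ≥ 1`, continuous `ρ`, `β ≥ 0`; reflection
`GaugeConfig.negReflect` fixing the slice `t = 0` and the temporal layer `S → S+1`): if a measurable
observable `Φ` satisfies, for all `U, Y`,
`Φ (translateLayer S Y U) = Σₖ gₖ(splice_{layerEdges S}(U, Y)) · conj gₖ(negReflect U)` for finitely
many bounded measurable `gₖ` depending only on the links of `negSideEdges S ∪ layerEdges S ∪
sliceZeroEdges` (times `S+1 … L−1`, the layer, the spatial links of slice `0`), then `⟨Φ⟩_{Λ,β} ≥ 0`.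
It is `wilsonExpectation_nonneg_of_oddCovariant` transported along the time translation `t ↦ t − S`
(translation invariance of the Wilson state). [cite: OsterwalderSeiler1978, §2] -/
theorem wilsonExpectation_nonneg_of_negCovariant [NeZero d] [NeZero L] {S : ℕ} (hL : L = 2 * S + 1)
    (hS : 1 ≤ S) (hρ : Continuous ρ) {β : ℝ} (hβ : 0 ≤ β)
    {K : Type*} [Fintype K] {g : K → GaugeConfig d L G → ℂ} (hgm : ∀ k, Measurable (g k))
    {Kg : ℝ} (hgb : ∀ k U, ‖g k U‖ ≤ Kg)
    (hgdep : ∀ k, DependsOn (g k)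
      (↑(negSideEdges S ∪ layerEdges S ∪ sliceZeroEdges : Finset (Edge d L)) : Set (Edge d L)))
    {Φ : GaugeConfig d L G → ℂ} (hΦm : Measurable Φ)
    (hcov : ∀ U Y, Φ (translateLayer S Y U) =
      ∑ k, g k (LatticeRP.splice (layerEdges S) (U, Y)) * conj (g k U.negReflect)) :
    0 ≤ wilsonExpectation ρ β Φ := by
  have hodd : Odd L := ⟨S, hL⟩
  have hL3 : 3 ≤ L := by omega
  set τ := torusConfigShift (G := G) (shiftVec (d := d) (L := L) S) with hτ
  have hτm : Measurable τ := (torusConfigShift (G := G) (shiftVec (d := d) (L := L) S)).measurable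
  rw [← wilsonExpectation_comp_torusConfigShift ρ β (shiftVec S) Φ]
  refine wilsonExpectation_nonneg_of_oddCovariant ρ hodd hL3 hρ hβ (K := K) (g := fun k => g k ∘ τ)
    (fun k => (hgm k).comp hτm) (Kg := Kg) (fun k U => hgb k _)
    (fun k => dependsOn_comp_torusConfigShift hL hS (hgdep k)) (hΦm.comp hτm) fun U' Y' => ?_
  simp only [Function.comp_apply, hτ]
  rw [torusConfigShift_translateLow hL, hcov, splice_layerEdges_torusConfigShift hL,
    negReflect_torusConfigShift hL]

end Main

end

end Literature.MathematicalPhysics.QuantumFieldTheory
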